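import Literature.NumberTheory.Automorphic.LocalComponentGeneric
import HarnessLib

/-!
# An irreducible `Π` is generated by the translates, away from `w`, of any local component at `w`
(the isotypic form of the statement "`π ≅ ⊗' π_v`" that is needed without Flath's theorem;
Jacquet–Langlands, LNM 114 (1970), §9–§10, Prop. 9.1 ff.: an irreducible admissible representation
of `GL₂(𝔸)` restricted to `GL₂(F_v) × GL₂(𝔸^v)`; Bump (1997), §3.3–3.4, Thm. 3.3.3 (Flath))

Topic `NumberTheory/Automorphic`; theorems only (no definition, no named fact, no instance
visible to importers). Let `Π ≤ L²(GL_n(K) A_G \ GL_n(𝔸_K))` be a closed subrepresentation which is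
**topologically irreducible** (`IsTopIrreducible`), `w` a finite place, `ρ` a representation of
`GL_n(K_w)` on `V` and `F : V → Π` a non-zero linear map with `F(ρ(a) x) = R(ι_w a) F(x)` (a local
component at `w`, `HasLocalComponentAt`). Then:

* `span_translates_localComponent_invariant` — the span `M` of the vectors `R(g) F(x)` with `g`
  **trivial at `w`** (`g_w = 1`) and `x ∈ V` is invariant under all of `GL_n(𝔸_K)`: for
  `g = s(g) ι_w(g_w)`, `R(g) R(g') F(x) = R(s(g) g') F(ρ(g_w) x)` because `ι_w(g_w)` commutes with
  the elements trivial at `w` (`GLn.toAdelic_mul_eq_mul_toAdelic`);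
* `topologicalClosure_span_translates_localComponent_eq_top` — **`M` is dense in `Π`** (its
  closure is a non-zero closed invariant subspace of the irreducible `Π`);
* `exists_inner_translate_localComponent_ne_zero` — hence **every non-zero `y ∈ Π` pairs
  non-trivially with some `R(g) F(x)`, `g_w = 1`**; and `R(g) ∘ F` is again a local component map
  at `w` (`translate_localComponent_intertwines`).

This replaces, in the non-vanishing arguments of the comparison of trace formulas at several
places (`SupercuspidalPlaceNonvanishing`), the restricted tensor product decomposition of `Π`.

## References

* H. Jacquet, R. P. Langlands, *Automorphic forms on `GL(2)`*, LNM 114 (1970), §9, Prop. 9.1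
  [JacquetLanglands1970].
* D. Bump, *Automorphic Forms and Representations* (1997), §3.3, Thm. 3.3.3 [Bump1997].
-/

noncomputable section

open MeasureTheory Measure Set Filter Topology IsDedekindDomain NumberField
open scoped InnerProductSpace

namespace Literature.NumberTheory.Automorphic

section Density

variable {n : ℕ} {K : Type} [Field K] [NumberField K] {w : HeightOneSpectrum (𝓞 K)}
  {μ : Measure (AdelicGroupData.gl n K).automorphicQuotient}
  [(AdelicGroupData.gl n K).IsAutomorphicMeasure μ]

attribute [local instance] adelicBorel borelSpace_adelic locallyCompactSpace_adelic
  secondCountableTopology_gl_adelic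

variable {W : ContRepresentation.ClosedSubrep ((AdelicGroupData.gl n K).rightRegular μ)}
  {V : Type*} [AddCommGroup V] [Module ℂ V]
  {ρ : Representation ℂ (GL (Fin n) (w.adicCompletion K)) V} {F : V →ₗ[ℂ] W.toSubmodule}

/-- **`R(g) ∘ F` is again a local component map at `w` for `g` trivial at `w`**:
`R(g) F(ρ(a) x) = R(g) R(ι_w a) F(x) = R(ι_w a) R(g) F(x)`. [folklore] -/
theorem translate_localComponent_intertwines
    (hF : ∀ (a : GL (Fin n) (w.adicCompletion K)) (x : V),
      F (ρ a x) = W.toContRep (GLn.toAdelic n K w a) (F x))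
    {g : (AdelicGroupData.gl n K).Adelic} (hg : GLn.toLocalAt n K w g = 1)
    (a : GL (Fin n) (w.adicCompletion K)) (x : V) :
    W.toContRep g (F (ρ a x)) = W.toContRep (GLn.toAdelic n K w a) (W.toContRep g (F x)) := by
  rw [hF]
  have hcomm : W.toContRep g * W.toContRep (GLn.toAdelic n K w a) =
      W.toContRep (GLn.toAdelic n K w a) * W.toContRep g := by
    rw [← map_mul, ← map_mul, GLn.toAdelic_mul_eq_mul_toAdelic hg a]
  exact congrArg (fun T : W.toSubmodule →L[ℂ] W.toSubmodule => T (F x)) hcomm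

/-- **The span of the `R(g) F(x)`, `g_w = 1`, is `GL_n(𝔸_K)`-invariant**: for arbitrary `g`,
writing `g = s(g) ι_w(g_w)`, `R(g) R(g') F(x) = R(s(g) g') F(ρ(g_w) x)` with `s(g) g'` trivial at
`w`. [cite: JacquetLanglands1970, §9 Prop. 9.1] -/
theorem span_translates_localComponent_invariant
    (hF : ∀ (a : GL (Fin n) (w.adicCompletion K)) (x : V),
      F (ρ a x) = W.toContRep (GLn.toAdelic n K w a) (F x))
    (g : (AdelicGroupData.gl n K).Adelic) {y : W.toSubmodule}
    (hy : y ∈ Submodule.span ℂ {y | ∃ (g : (AdelicGroupData.gl n K).Adelic) (x : V),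
      GLn.toLocalAt n K w g = 1 ∧ y = W.toContRep g (F x)}) :
    W.toContRep g y ∈ Submodule.span ℂ {y | ∃ (g : (AdelicGroupData.gl n K).Adelic) (x : V),
      GLn.toLocalAt n K w g = 1 ∧ y = W.toContRep g (F x)} := by
  set S : Set W.toSubmodule := {y | ∃ (g : (AdelicGroupData.gl n K).Adelic) (x : V),
    GLn.toLocalAt n K w g = 1 ∧ y = W.toContRep g (F x)} with hS
  have hle : Submodule.span ℂ S ≤ (Submodule.span ℂ S).comap
      ((W.toContRep g : W.toSubmodule →L[ℂ] W.toSubmodule) : W.toSubmodule →ₗ[ℂ] W.toSubmodule) := by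
    rw [Submodule.span_le]
    rintro _ ⟨g', x, hg', rfl⟩
    rw [SetLike.mem_coe, Submodule.mem_comap, ContinuousLinearMap.coe_coe]
    refine Submodule.subset_span ⟨GLn.awayFrom n K w g * g', ρ (GLn.toLocalAt n K w g) x, ?_, ?_⟩
    · rw [map_mul, hg', mul_one, GLn.toLocal_awayFrom]
    · rw [hF]
      have hcomm : W.toContRep g * W.toContRep g' =
          W.toContRep (GLn.awayFrom n K w g * g') *
            W.toContRep (GLn.toAdelic n K w (GLn.toLocalAt n K w g)) := by
        rw [← map_mul, ← map_mul, mul_assoc, ← GLn.toAdelic_mul_eq_mul_toAdelic hg', ← mul_assoc,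
          GLn.awayFrom_mul_toAdelic]
      exact congrArg (fun T : W.toSubmodule →L[ℂ] W.toSubmodule => T (F x)) hcomm
  exact hle hy

/-- **The translates `R(g) F(x)`, `g_w = 1`, span a dense subspace of an irreducible `Π`** (for
`F ≠ 0`): the closure of their span is a closed invariant subspace
(`span_translates_localComponent_invariant` and continuity of the `R(g)`) containing
`F(x) ≠ 0`, hence all of `Π` by topological irreducibility. [cite: JacquetLanglands1970, §9 Prop. 9.1] -/
theorem topologicalClosure_span_translates_localComponent_eq_top
    (hirr : W.toContRep.IsTopIrreducible)
    (hF : ∀ (a : GL (Fin n) (w.adicCompletion K)) (x : V),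
      F (ρ a x) = W.toContRep (GLn.toAdelic n K w a) (F x)) (hF0 : F ≠ 0) :
    (Submodule.span ℂ {y | ∃ (g : (AdelicGroupData.gl n K).Adelic) (x : V),
      GLn.toLocalAt n K w g = 1 ∧ y = W.toContRep g (F x)}).topologicalClosure = ⊤ := by
  set M : Submodule ℂ W.toSubmodule := Submodule.span ℂ {y | ∃ (g : (AdelicGroupData.gl n K).Adelic)
    (x : V), GLn.toLocalAt n K w g = 1 ∧ y = W.toContRep g (F x)} with hM
  -- the closure of `M` as a closed subrepresentation of `W.toContRep`
  let Q : ContRepresentation.ClosedSubrep W.toContRep :=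
    { toSubmodule := M.topologicalClosure
      apply_mem_toSubmodule := fun g v hv => by
        have hmaps : Set.MapsTo (W.toContRep g) (M : Set W.toSubmodule) (M : Set W.toSubmodule) :=
          fun x hx => span_translates_localComponent_invariant hF g hx
        have hcl := hmaps.closure (W.toContRep g).continuous
        rw [← Submodule.topologicalClosure_coe] at hcl
        exact hcl hv
      isClosed' := Submodule.isClosed_topologicalClosure _ }
  -- `Q ≠ ⊥`
  obtain ⟨x, hx⟩ : ∃ x, F x ≠ 0 := by
    by_contra h
    push Not at h
    exact hF0 (LinearMap.ext h)
  have hFx : F x ∈ Q := by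
    change F x ∈ M.topologicalClosure
    refine M.le_topologicalClosure (Submodule.subset_span ⟨1, x, map_one _, ?_⟩)
    rw [map_one]
    rfl
  have hQ : Q ≠ ⊥ := by
    intro h
    rw [h, ContRepresentation.ClosedSubrep.mem_bot] at hFx
    exact hx hFx
  haveI : IsSimpleOrder (ContRepresentation.ClosedSubrep W.toContRep) := hirr
  have hQtop : Q = ⊤ := (eq_bot_or_eq_top Q).resolve_left hQ
  -- hence `M.topologicalClosure = ⊤`
  refine Submodule.eq_top_iff'.2 fun y => ?_
  have hy : y ∈ Q := by rw [hQtop]; exact ContRepresentation.ClosedSubrep.mem_top y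
  exact hy

/-- **Every non-zero `y ∈ Π` pairs non-trivially with some translate `R(g) F(x)`, `g_w = 1`** of a
non-zero local component map `F` at `w` (`Π` topologically irreducible): the span of these
translates is dense, so its orthogonal complement is `0`. [cite: JacquetLanglands1970, §9 Prop. 9.1] -/
theorem exists_inner_translate_localComponent_ne_zero
    (hirr : W.toContRep.IsTopIrreducible)
    (hF : ∀ (a : GL (Fin n) (w.adicCompletion K)) (x : V),
      F (ρ a x) = W.toContRep (GLn.toAdelic n K w a) (F x)) (hF0 : F ≠ 0)
    {y : W.toSubmodule} (hy : y ≠ 0) :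
    ∃ (g : (AdelicGroupData.gl n K).Adelic) (x : V), GLn.toLocalAt n K w g = 1 ∧
      ⟪y, W.toContRep g (F x)⟫_ℂ ≠ 0 := by
  haveI : CompleteSpace W.toSubmodule := W.isClosed'.completeSpace_coe
  by_contra h
  push Not at h
  set M : Submodule ℂ W.toSubmodule := Submodule.span ℂ {y | ∃ (g : (AdelicGroupData.gl n K).Adelic)
    (x : V), GLn.toLocalAt n K w g = 1 ∧ y = W.toContRep g (F x)} with hM
  have hdense := topologicalClosure_span_translates_localComponent_eq_top hirr hF hF0
  have horth : Mᗮ = ⊥ := (Submodule.topologicalClosure_eq_top_iff).1 hdense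
  -- `y ∈ Mᗮ`
  have hyM : y ∈ Mᗮ := by
    rw [Submodule.mem_orthogonal]
    intro u hu
    refine Submodule.span_induction (p := fun u _ => ⟪u, y⟫_ℂ = 0) ?_ ?_ ?_ ?_ hu
    · rintro _ ⟨g, x, hg, rfl⟩
      rw [← inner_conj_symm (W.toContRep g (F x)) y, h g x hg, map_zero]
    · exact inner_zero_left y
    · intro a b _ _ ha hb
      rw [inner_add_left, ha, hb, add_zero]
    · intro c a _ ha
      rw [inner_smul_left, ha, mul_zero]
  rw [horth, Submodule.mem_bot] at hyM
  exact hy hyM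

end Density

end Literature.NumberTheory.Automorphic
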